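import Mathlib.Analysis.InnerProductSpace.Basic
import HarnessLib

/-!
# Stability of orthogonal (minimising) representatives under a perturbation of the inner product

Topic: elementary Hilbert-space geometry (no completeness needed). Theorems only, no new facts.

Let `E` be a vector space with a reference Hermitian form `B₁` (think: the `L²` product of a
compact Riemannian manifold on smooth `k`-forms) and a second form `B₂` close to it,
`|B₂(a, c) - B₁(a, c)| ≤ ε (B₁(a, a) + B₁(c, c))` (think: the transported `L²` product of a nearby
fibre). If `u₁` is `B₁`-orthogonal and `u₂` is `B₂`-orthogonal to a subspace `D` (the exact forms)
and `u₂ - u₁ ∈ D` (both represent the same cohomology class), then `v = u₂ - u₁` is small: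
`(1 - 3ε) B₁(v, v) ≤ ε B₁(u₁, u₁)` (`re_apply_sub_sub_le_of_orthogonal`), i.e. in an inner product
space `‖u₂ - u₁‖² ≤ ε / (1 - 3ε) · ‖u₁‖²` (`norm_sub_sq_le_of_orthogonal`). Indeed
`B₂(v, v) = B₂(u₂, v) - B₂(u₁, v) = -(B₂ - B₁)(u₁, v)` as `B₁(u₁, v) = 0 = B₂(u₂, v)`.
This is the mechanism of the continuity of harmonic representatives in a family of metrics
(Kodaira–Spencer; cf. Voisin (2002), §9.3), in a form that needs no elliptic estimate.

## References

* C. Voisin, *Hodge Theory and Complex Algebraic Geometry I*, CUP (2002), §5.3.1, Thm. 5.23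
  (harmonic forms represent cohomology: the harmonic representative is the one orthogonal to the
  exact forms), §9.3 (variation of the structures); held text PDF p. 111. [VoisinHodgeI2002]
-/

noncomputable section

open Complex

namespace Literature.Analysis.InnerProduct

/-- **Stability of orthogonal representatives, algebraic form.** Let `B₁ B₂ : E → E → ℂ` with `B₂`
additive in the first variable, `Re B₁(a, a) ≥ 0`, and
`‖B₂(a, c) - B₁(a, c)‖ ≤ ε (Re B₁(a, a) + Re B₁(c, c))` for all `a, c`. If `u₂ - u₁ ∈ D`,
`B₁(u₁, v) = 0` and `B₂(u₂, v) = 0` for all `v ∈ D`, then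
`(1 - 3ε) Re B₁(u₂ - u₁, u₂ - u₁) ≤ ε Re B₁(u₁, u₁)`. [cite: VoisinHodgeI2002, §5.3.1 Thm. 5.23] -/
theorem re_apply_sub_sub_le_of_orthogonal {E : Type*} [AddCommGroup E] (B₁ B₂ : E → E → ℂ)
    (D : Set E) {ε : ℝ} (hB₂sub : ∀ a b v, B₂ (a - b) v = B₂ a v - B₂ b v)
    (happrox : ∀ a c, ‖B₂ a c - B₁ a c‖ ≤ ε * ((B₁ a a).re + (B₁ c c).re))
    {u₁ u₂ : E} (hD : u₂ - u₁ ∈ D) (h₁ : ∀ v ∈ D, B₁ u₁ v = 0) (h₂ : ∀ v ∈ D, B₂ u₂ v = 0) :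
    (1 - 3 * ε) * (B₁ (u₂ - u₁) (u₂ - u₁)).re ≤ ε * (B₁ u₁ u₁).re := by
  set v := u₂ - u₁ with hv
  -- `B₂(v, v) = -(B₂ - B₁)(u₁, v)`
  have hkey : B₂ v v = -(B₂ u₁ v - B₁ u₁ v) := by
    rw [hv, hB₂sub, h₂ _ hD, h₁ _ hD, zero_sub, sub_zero, ← hv]
  -- the two uses of the approximation hypothesis
  have hA : (B₂ v v).re ≤ ε * ((B₁ u₁ u₁).re + (B₁ v v).re) := by
    rw [hkey, neg_re]
    exact (neg_le_abs _).trans ((Complex.abs_re_le_norm _).trans (happrox u₁ v))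
  have hB : (B₁ v v).re - ε * ((B₁ v v).re + (B₁ v v).re) ≤ (B₂ v v).re := by
    have h := (Complex.abs_re_le_norm _).trans (happrox v v)
    rw [sub_re] at h
    linarith [(abs_le.1 h).1]
  nlinarith [hA, hB]

/-- **Stability of orthogonal representatives in an inner product space**: with `B₁ = ⟪·, ·⟫`,
under the hypotheses of `re_apply_sub_sub_le_of_orthogonal` and `ε < 1/3`,
`‖u₂ - u₁‖² ≤ ε / (1 - 3ε) · ‖u₁‖²`. [cite: VoisinHodgeI2002, §5.3.1 Thm. 5.23] -/
theorem norm_sub_sq_le_of_orthogonal {E : Type*} [SeminormedAddCommGroup E] [InnerProductSpace ℂ E]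
    (B₂ : E → E → ℂ) (D : Set E) {ε : ℝ} (hε : ε < 1 / 3)
    (hB₂sub : ∀ a b v, B₂ (a - b) v = B₂ a v - B₂ b v)
    (happrox : ∀ a c, ‖B₂ a c - inner ℂ a c‖ ≤ ε * (‖a‖ ^ 2 + ‖c‖ ^ 2))
    {u₁ u₂ : E} (hD : u₂ - u₁ ∈ D) (h₁ : ∀ v ∈ D, inner ℂ u₁ v = 0)
    (h₂ : ∀ v ∈ D, B₂ u₂ v = 0) :
    ‖u₂ - u₁‖ ^ 2 ≤ ε / (1 - 3 * ε) * ‖u₁‖ ^ 2 := by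
  have hre : ∀ a : E, (inner ℂ a a).re = ‖a‖ ^ 2 := fun a ↦ by
    rw [← @inner_self_eq_norm_sq ℂ]
    rfl
  have happrox' : ∀ a c, ‖B₂ a c - inner ℂ a c‖ ≤
      ε * ((inner ℂ a a).re + (inner ℂ c c).re) := fun a c ↦ by
    rw [hre, hre]; exact happrox a c
  have h := re_apply_sub_sub_le_of_orthogonal (fun a c ↦ inner ℂ a c) B₂ D hB₂sub happrox' hD h₁ h₂
  rw [hre, hre] at h
  have h3 : 0 < 1 - 3 * ε := by linarith
  rw [div_mul_eq_mul_div, le_div_iff₀ h3]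
  linarith

end Literature.Analysis.InnerProduct
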